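import Summits.Ventures.PercRepro.S4UpsCellP12D74
import Summits.Ventures.PercRepro.S4UpsCellP11D74
import Summits.Ventures.PercRepro.S4UpsCellP10D74
import Summits.Ventures.PercRepro.S4SevenPhiB
import Summits.Ventures.PercRepro.S4SevenDevice

/-!
# PercRepro — THE CORE CELLS `(12, d)`, `d ∈ {74}`, OF THE 12 ROW AT LEVEL `7` BY THE GENERIC COLOOP DEVICE (p7 g24, S4 feeder;
p9 owns S4 — no window claim)

Each core cell `(12, d)` (every `e`-free core of rank `12` on `12 + d` points) is ONE instantiation of `c025_core_seven_of_cells` (S4SevenDevice): `K = 3` layers —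
`k` coloops (`k < 3`) reduce to the NATURAL cell `(12 − k, d)` (`S3LP.s7lp_<12−k>_<n>`, p8's statement shape, the rows 12, 11, 10 at the same corank)
with its natural constant `Φ(12 − k, 7)`, admitted by the lossy ladder (`Φ(12,7) = 20 / 3 ≤ 2^k·Φ(12−k,7) + 2(2^k − 1)`); `3` coloops or more retire the cell
(`Φ(12,7) ≤ 2(2^3 − 1) = 14`). Names as p7 g23's device cells (`c025_core_seven_twelve_<d>`). Nothing else is claimed.
Axioms: standard.
-/

open scoped Matroid

namespace PercRepro

namespace ThmN

variable {α : Type}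

/-- **The core cell `(12, 74)`, every `e`-free core** — the generic coloop device on the natural cells `(12 − k, 74)`, `k < 3`. -/
theorem c025_core_seven_twelve_74 (M : Matroid α) [M.Finite]
    (hR : M.eRank = (12 : ℕ∞)) (hn : M.E.ncard = 12 + 74)
    (hfree : ∀ e ∈ M.E, ∃ A ⊆ M.E \ {e}, e ∉ M.closure A ∧ e ∉ M.closure ((M.E \ {e}) \ A)) : RLS M 12 7 :=
  c025_core_seven_of_cells M 12 74 3 (by norm_num) (by norm_num [S4Ups.phiK_twelve_seven])
    (by
      intro k hk
      interval_cases k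
      · exact ⟨20 / 3, by norm_num [S4Ups.phiK_twelve_seven], fun N _ h1 h2 h3 h4 h5 h6 h7 h8 => S3LP.s7lp_12_86 N h1 h2 h3 h4 h5 h6 h7 h8⟩
      · exact ⟨77 / 18, by norm_num [S4Ups.phiK_twelve_seven], fun N _ h1 h2 h3 h4 h5 h6 h7 h8 => S3LP.s7lp_11_85 N h1 h2 h3 h4 h5 h6 h7 h8⟩
      · exact ⟨5 / 2, by norm_num [S4Ups.phiK_twelve_seven], fun N _ h1 h2 h3 h4 h5 h6 h7 h8 => S3LP.s7lp_10_84 N h1 h2 h3 h4 h5 h6 h7 h8⟩)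
    hR hn hfree

end ThmN

end PercRepro
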